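import Summits.RiemannHypothesis.RiemannHypothesis.Theorems.SignConeConeMagnificationCombTypeNodeSimple
import Summits.RiemannHypothesis.RiemannHypothesis.Theorems.SignConeConeMagnificationCombTypeNodeCorner
import Literature.NumberTheory.LFunctions.WeilCombTwoPointSummable
import Literature.NumberTheory.LFunctions.MontgomeryOffDiagonalTools

/-!
# Crux `SignCone.ConeMagnification` (stmt-RiemannHypothesis-16303), line `Sketch` r9, stub `stub_combType` — sharp node evaluation IX:
# numeric bounds for the error sums (window `√(log M)/M`)

Backstop, part 9 (tools for `…CombTypeSharpData`): powers of `log M` (`CombType.logpow_facts`, `CombType.one_add_log_sq_le`), the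
main-range threshold `n₁ = ⌊M/(8κL²)⌋` (`CombType.mainRange_threshold`), the two error sums against a Chebyshev weight
(`CombType.sum_main_errors_le`, `CombType.sum_corner_errors_le`), and the three numeric bounds `CombType.bound_e0`, `CombType.bound_e1`,
`CombType.bound_corner` turning them into `O((log M)^{3/4})`.
-/

noncomputable section

-- `Summit.RiemannHypothesis.RiemannHypothesis.…` repeats a namespace component by design (D-0017 layout).
set_option linter.dupNamespace false

open scoped BigOperators ArithmeticFunction.vonMangoldt
open MeasureTheory Set

namespace Summit.RiemannHypothesis.RiemannHypothesis.Theorems.SignConeConeMagnification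

open Literature.NumberTheory.LFunctions

namespace CombType

/-- Powers of `log M`: with `κ = √(log M)` and `R = (log M)^{3/4}` (`log M ≥ 1`): `1 ≤ R`, `κ ≤ R`, `√κ ≤ R`, `κ² = log M`. [folklore] -/
theorem logpow_facts {x : ℝ} (hx : 1 ≤ x) :
    1 ≤ x ^ (3 / 4 : ℝ) ∧ Real.sqrt x ≤ x ^ (3 / 4 : ℝ) ∧ Real.sqrt (Real.sqrt x) ≤ x ^ (3 / 4 : ℝ) ∧
      Real.sqrt x * Real.sqrt x = x := by
  have hx0 : 0 ≤ x := by linarith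
  refine ⟨Real.one_le_rpow hx (by norm_num), ?_, ?_, Real.mul_self_sqrt hx0⟩
  · rw [Real.sqrt_eq_rpow]; exact Real.rpow_le_rpow_of_exponent_le hx (by norm_num)
  · rw [Real.sqrt_eq_rpow, Real.sqrt_eq_rpow, ← Real.rpow_mul hx0]
    exact Real.rpow_le_rpow_of_exponent_le hx (by norm_num)

/-- `(1 + log M)² ≤ 9M` for `M ≥ 1`. [folklore] -/
theorem one_add_log_sq_le {M : ℝ} (hM : 1 ≤ M) : (1 + Real.log M) ^ 2 ≤ 9 * M := by
  have hM0 : 0 < M := by linarith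
  have h1 := Literature.NumberTheory.Sieve.SelbergSymmetry.log_le_two_mul_sqrt hM0
  have hs : 1 ≤ Real.sqrt M := by rw [Real.le_sqrt' one_pos, one_pow]; exact hM
  have hlog0 : 0 ≤ Real.log M := Real.log_nonneg hM
  have h2 : 1 + Real.log M ≤ 3 * Real.sqrt M := by linarith
  calc (1 + Real.log M) ^ 2 ≤ (3 * Real.sqrt M) ^ 2 := pow_le_pow_left₀ (by linarith) h2 2
    _ = 9 * M := by rw [mul_pow, Real.sq_sqrt hM0.le]; ring

/-- The thresholds of the main range: for `M ≥ 4L⁴` (and the parameter facts of `comb_params_of_large`),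
`n₁ = ⌊1/(8hL²)⌋ ≥ 1`, `n₁ ≤ 3LM`, and `log(3LM) − log(n₁+1) ≤ 24κL³` (`h = κ/M`). [folklore] -/
theorem mainRange_threshold {κ : ℝ} {L M : ℕ} (hL : 1 ≤ L) (hκ1 : 1 ≤ κ) (hM0 : (0 : ℝ) < M)
    (hY1 : Real.sqrt M ≤ M / (4 * κ)) (hM4 : 4 * (L : ℝ) ^ 4 ≤ M) :
    1 ≤ ⌊1 / (8 * (κ / M) * L ^ 2)⌋₊ ∧ ⌊1 / (8 * (κ / M) * L ^ 2)⌋₊ ≤ 3 * L * M ∧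
      Real.log ((3 * L * M : ℕ) : ℝ) - Real.log ((⌊1 / (8 * (κ / M) * L ^ 2)⌋₊ : ℝ) + 1) ≤ 24 * κ * L ^ 3 := by
  have hLR : (1 : ℝ) ≤ L := by exact_mod_cast hL
  have hκ0 : 0 < κ := by linarith
  set y : ℝ := 1 / (8 * (κ / M) * L ^ 2) with hy
  have hy' : y = M / (8 * κ * L ^ 2) := by rw [hy]; field_simp
  have hy0 : 0 < y := by rw [hy']; positivity
  -- `κ ≤ √M/4` and `2L² ≤ √M`
  have hsM : 0 < Real.sqrt M := Real.sqrt_pos.2 hM0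
  have hκs : 4 * κ ≤ Real.sqrt M := by
    have h1 : Real.sqrt M * (4 * κ) ≤ M := by rwa [le_div_iff₀ (by positivity)] at hY1
    have h2 : Real.sqrt M * (4 * κ) ≤ Real.sqrt M * Real.sqrt M := by rw [Real.mul_self_sqrt hM0.le]; exact h1
    exact le_of_mul_le_mul_left h2 hsM
  have hL2 : 2 * (L : ℝ) ^ 2 ≤ Real.sqrt M := by
    rw [show (2 * (L : ℝ) ^ 2) = Real.sqrt ((2 * (L : ℝ) ^ 2) ^ 2) from (Real.sqrt_sq (by positivity)).symm]
    exact Real.sqrt_le_sqrt (by nlinarith)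
  have hy1 : 1 ≤ y := by
    rw [hy', le_div_iff₀ (by positivity), one_mul]
    calc 8 * κ * (L : ℝ) ^ 2 = (4 * κ) * (2 * L ^ 2) := by ring
      _ ≤ Real.sqrt M * Real.sqrt M := mul_le_mul hκs hL2 (by positivity) hsM.le
      _ = M := Real.mul_self_sqrt hM0.le
  have hfl : y - 1 < ⌊y⌋₊ := by have := Nat.lt_floor_add_one y; linarith
  refine ⟨by rw [Nat.one_le_floor_iff]; exact hy1, ?_, ?_⟩
  · have : (⌊y⌋₊ : ℝ) ≤ 3 * L * M := by
      calc (⌊y⌋₊ : ℝ) ≤ y := Nat.floor_le hy0.le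
        _ ≤ M := by
            rw [hy', div_le_iff₀ (by positivity)]
            have : (1 : ℝ) ≤ 8 * κ * L ^ 2 := by nlinarith
            nlinarith
        _ ≤ 3 * L * M := by nlinarith
    exact_mod_cast this
  · have hpos : (0 : ℝ) < (⌊y⌋₊ : ℝ) + 1 := by positivity
    have h3LM : (0 : ℝ) < ((3 * L * M : ℕ) : ℝ) := by push_cast; positivity
    rw [← Real.log_div h3LM.ne' hpos.ne']
    have hq : ((3 * L * M : ℕ) : ℝ) / ((⌊y⌋₊ : ℝ) + 1) ≤ 24 * κ * L ^ 3 := by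
      rw [div_le_iff₀ hpos]
      have : ((3 * L * M : ℕ) : ℝ) = 24 * κ * L ^ 3 * y := by push_cast; rw [hy']; field_simp; ring
      rw [this]
      nlinarith [hfl.le, show (0:ℝ) ≤ 24 * κ * L ^ 3 by positivity]
    have hq0 : 0 < ((3 * L * M : ℕ) : ℝ) / ((⌊y⌋₊ : ℝ) + 1) := div_pos h3LM hpos
    calc Real.log (((3 * L * M : ℕ) : ℝ) / ((⌊y⌋₊ : ℝ) + 1)) ≤ ((3 * L * M : ℕ) : ℝ) / ((⌊y⌋₊ : ℝ) + 1) - 1 :=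
          Real.log_le_sub_one_of_pos hq0
      _ ≤ 24 * κ * L ^ 3 := by linarith

/-- Main-range error sum: `Σ_{n ≤ n₁} f(n)(e₀ + e₁/n) ≤ e₁A(1 + log n₁) + e₀An₁`. [folklore] -/
theorem sum_main_errors_le {f : ℕ → ℝ} {A e₀ e₁ : ℝ} (hf0 : ∀ n, 0 ≤ f n)
    (hA : ∀ N : ℕ, 1 ≤ N → ∑ n ∈ Finset.Icc 1 N, f n ≤ A * N) (he₀ : 0 ≤ e₀) (he₁ : 0 ≤ e₁) {n₁ : ℕ} (hn₁ : 1 ≤ n₁) :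
    ∑ n ∈ Finset.Icc 1 n₁, f n * (e₀ + e₁ / n) ≤ e₁ * (A * (1 + Real.log n₁)) + e₀ * (A * n₁) := by
  have h := sum_mul_error_le (C := e₁) (C' := e₀) (h := 1) hf0 hA he₁ he₀ zero_le_one hn₁
  simp only [mul_one] at h
  have e : ∑ n ∈ Finset.Icc 1 n₁, f n * (e₀ + e₁ / n) = ∑ n ∈ Finset.Icc 1 n₁, f n * (e₁ / n + e₀) :=
    Finset.sum_congr rfl fun n _ => by ring
  rw [e]; linarith

/-- Corner error sum: `Σ_{n₁ < n ≤ N} f(n)(C/n + D) ≤ CA(2 + log N − log(n₁+1)) + DAN`. [folklore] -/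
theorem sum_corner_errors_le {f : ℕ → ℝ} {A C D : ℝ} (hf0 : ∀ n, 0 ≤ f n)
    (hA : ∀ N : ℕ, 1 ≤ N → ∑ n ∈ Finset.Icc 1 N, f n ≤ A * N) (hC : 0 ≤ C) (hD : 0 ≤ D) {n₁ N : ℕ} (hn₁ : 1 ≤ n₁) (hN : n₁ ≤ N) :
    ∑ n ∈ Finset.Ioc n₁ N, f n * (C / n + D) ≤ C * (A * (2 + Real.log N - Real.log (n₁ + 1))) + D * (A * N) := by
  have h1 := sum_div_Ioc_le_of_chebyshev hf0 hA hn₁ hN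
  have h2 : ∑ n ∈ Finset.Ioc n₁ N, f n ≤ A * N := by
    have hsub : Finset.Ioc n₁ N ⊆ Finset.Icc 1 N := fun n hn => by
      simp only [Finset.mem_Ioc, Finset.mem_Icc] at hn ⊢; omega
    exact (Finset.sum_le_sum_of_subset_of_nonneg hsub fun n _ _ => hf0 n).trans (hA N (hn₁.trans hN))
  have e : ∑ n ∈ Finset.Ioc n₁ N, f n * (C / n + D) = C * ∑ n ∈ Finset.Ioc n₁ N, f n / n + D * ∑ n ∈ Finset.Ioc n₁ N, f n := by
    rw [Finset.mul_sum, Finset.mul_sum, ← Finset.sum_add_distrib]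
    exact Finset.sum_congr rfl fun n _ => by ring
  rw [e]
  exact add_le_add (mul_le_mul_of_nonneg_left h1 hC) (mul_le_mul_of_nonneg_left h2 hD)

/-- Numeric bound for the main-range uniform errors: `e₀·A'n₁ ≤ A'·Ke₀·R`. [folklore] -/
theorem bound_e0 {h κ Lr N₀ N₁ A' R n₁ : ℝ} (hL : 1 ≤ Lr) (hA' : 0 ≤ A') (hN₀ : 0 ≤ N₀) (hN₁ : 0 ≤ N₁)
    (hκ0 : 0 ≤ κ) (hR1 : 1 ≤ R) (hsκR : Real.sqrt κ ≤ R) (hn₁ : h * n₁ ≤ 1 / (8 * Lr ^ 2)) :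
    h * Lr ^ 2 * ((32 * N₁ + 28 * N₀) * (1 + 7 * Real.sqrt (κ * Lr)) + 48 * N₀) * (A' * n₁)
      ≤ A' * ((32 * N₁ + 28 * N₀) * (1 + 7 * Real.sqrt Lr) + 48 * N₀) * R := by
  have hsL : 0 ≤ Real.sqrt Lr := Real.sqrt_nonneg _
  have hsqrt : Real.sqrt (κ * Lr) ≤ R * Real.sqrt Lr := by
    rw [Real.sqrt_mul hκ0]; exact mul_le_mul_of_nonneg_right hsκR hsL
  have hbr : (32 * N₁ + 28 * N₀) * (1 + 7 * Real.sqrt (κ * Lr)) + 48 * N₀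
      ≤ ((32 * N₁ + 28 * N₀) * (1 + 7 * Real.sqrt Lr) + 48 * N₀) * R := by
    have t1 : 1 + 7 * Real.sqrt (κ * Lr) ≤ (1 + 7 * Real.sqrt Lr) * R := by nlinarith
    have t2 := mul_le_mul_of_nonneg_left t1 (by positivity : (0 : ℝ) ≤ 32 * N₁ + 28 * N₀)
    have t3 : 48 * N₀ * 1 ≤ 48 * N₀ * R := mul_le_mul_of_nonneg_left hR1 (by positivity)
    nlinarith
  have hbr0 : 0 ≤ (32 * N₁ + 28 * N₀) * (1 + 7 * Real.sqrt (κ * Lr)) + 48 * N₀ := by positivity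
  calc h * Lr ^ 2 * ((32 * N₁ + 28 * N₀) * (1 + 7 * Real.sqrt (κ * Lr)) + 48 * N₀) * (A' * n₁)
      = A' * (h * n₁) * Lr ^ 2 * ((32 * N₁ + 28 * N₀) * (1 + 7 * Real.sqrt (κ * Lr)) + 48 * N₀) := by ring
    _ ≤ A' * (1 / (8 * Lr ^ 2)) * Lr ^ 2 * (((32 * N₁ + 28 * N₀) * (1 + 7 * Real.sqrt Lr) + 48 * N₀) * R) := by
        refine mul_le_mul (mul_le_mul_of_nonneg_right (mul_le_mul_of_nonneg_left hn₁ hA') (by positivity)) hbr hbr0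
          (by positivity)
    _ = A' * ((32 * N₁ + 28 * N₀) * (1 + 7 * Real.sqrt Lr) + 48 * N₀) * R / 8 := by field_simp
    _ ≤ A' * ((32 * N₁ + 28 * N₀) * (1 + 7 * Real.sqrt Lr) + 48 * N₀) * R := by
        have : 0 ≤ A' * ((32 * N₁ + 28 * N₀) * (1 + 7 * Real.sqrt Lr) + 48 * N₀) * R := by positivity
        linarith

/-- Numeric bound for the main-range `1/n` errors: `e₁·A'(1 + log n₁) ≤ A'·Ke₁·R`. [folklore] -/
theorem bound_e1 {h κ M Lr C₂ N₀ N₁ N₂ A' R lg lgn : ℝ} (hM : 0 < M) (hκ1 : 1 ≤ κ) (hhdef : h = κ / M)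
    (hκsq : κ * κ = lg) (hlg0 : 0 ≤ lg) (hsq9 : (1 + lg) ^ 2 ≤ 9 * M) (hκR : κ ≤ R) (hR1 : 1 ≤ R) (hlgn : lgn ≤ lg)
    (hL : 1 ≤ Lr) (hA' : 0 ≤ A') (hN₀ : 0 ≤ N₀) (hN₁ : 0 ≤ N₁) (hN₂ : 0 ≤ N₂) (hC₂ : 0 ≤ C₂) :
    (h * (h * M) * Lr ^ 3 * (3072 * N₁ + 264 * N₀) + h * (1 + lg) * Lr * (192 * N₁ + 12 * N₀)
        + (4 * C₂ + 10 * N₂) * Lr ^ 2 / (h * M)) * (A' * (1 + lgn))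
      ≤ A' * (9 * Lr ^ 3 * (3072 * N₁ + 264 * N₀) + 9 * Lr * (192 * N₁ + 12 * N₀) + 2 * (4 * C₂ + 10 * N₂) * Lr ^ 2) * R := by
  have hκ0 : 0 < κ := by linarith
  have hh0 : 0 < h := by rw [hhdef]; positivity
  have hhM : h * M = κ := by rw [hhdef]; field_simp
  have h1lg : 0 ≤ 1 + lg := by linarith
  rw [hhM]
  set e₁ : ℝ := h * κ * Lr ^ 3 * (3072 * N₁ + 264 * N₀) + h * (1 + lg) * Lr * (192 * N₁ + 12 * N₀)
    + (4 * C₂ + 10 * N₂) * Lr ^ 2 / κ with he₁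
  have he₁0 : 0 ≤ e₁ := by positivity
  -- `e₁ (1 + lg) ≤ Ke₁ R`
  have hhκ : h * κ * (1 + lg) ≤ 9 := by
    rw [hhdef, div_mul_eq_mul_div, hκsq, div_mul_eq_mul_div, div_le_iff₀ hM]
    nlinarith
  have t1 : h * κ * Lr ^ 3 * (3072 * N₁ + 264 * N₀) * (1 + lg) ≤ 9 * Lr ^ 3 * (3072 * N₁ + 264 * N₀) := by
    have := mul_le_mul_of_nonneg_left hhκ (by positivity : (0 : ℝ) ≤ Lr ^ 3 * (3072 * N₁ + 264 * N₀))
    nlinarith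
  have hq2 : h * (1 + lg) ^ 2 ≤ 9 * R := by
    have : h * (1 + lg) ^ 2 ≤ 9 * κ := by
      rw [hhdef, div_mul_eq_mul_div, div_le_iff₀ hM]; nlinarith
    nlinarith
  have t2 : h * (1 + lg) * Lr * (192 * N₁ + 12 * N₀) * (1 + lg) ≤ 9 * Lr * (192 * N₁ + 12 * N₀) * R := by
    have := mul_le_mul_of_nonneg_left hq2 (by positivity : (0 : ℝ) ≤ Lr * (192 * N₁ + 12 * N₀))
    nlinarith
  have hq3 : (1 + lg) / κ ≤ 2 * R := by
    have : (1 + lg) / κ ≤ 2 * κ := by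
      rw [div_le_iff₀ hκ0, ← hκsq]
      nlinarith
    nlinarith
  have t3 : (4 * C₂ + 10 * N₂) * Lr ^ 2 / κ * (1 + lg) ≤ 2 * (4 * C₂ + 10 * N₂) * Lr ^ 2 * R := by
    have := mul_le_mul_of_nonneg_left hq3 (by positivity : (0 : ℝ) ≤ (4 * C₂ + 10 * N₂) * Lr ^ 2)
    calc (4 * C₂ + 10 * N₂) * Lr ^ 2 / κ * (1 + lg) = (4 * C₂ + 10 * N₂) * Lr ^ 2 * ((1 + lg) / κ) := by
          field_simp
      _ ≤ (4 * C₂ + 10 * N₂) * Lr ^ 2 * (2 * R) := this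
      _ = _ := by ring
  have hstep : e₁ * (1 + lg) ≤ (9 * Lr ^ 3 * (3072 * N₁ + 264 * N₀) + 9 * Lr * (192 * N₁ + 12 * N₀)
      + 2 * (4 * C₂ + 10 * N₂) * Lr ^ 2) * R := by
    have e : e₁ * (1 + lg) = h * κ * Lr ^ 3 * (3072 * N₁ + 264 * N₀) * (1 + lg)
        + h * (1 + lg) * Lr * (192 * N₁ + 12 * N₀) * (1 + lg) + (4 * C₂ + 10 * N₂) * Lr ^ 2 / κ * (1 + lg) := by
      rw [he₁]; ring
    rw [e]
    have hR1' : 9 * Lr ^ 3 * (3072 * N₁ + 264 * N₀) ≤ 9 * Lr ^ 3 * (3072 * N₁ + 264 * N₀) * R := by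
      have := mul_le_mul_of_nonneg_left hR1 (by positivity : (0 : ℝ) ≤ 9 * Lr ^ 3 * (3072 * N₁ + 264 * N₀))
      linarith
    linarith [t1, t2, t3, hR1']
  have hmono : e₁ * (A' * (1 + lgn)) ≤ e₁ * (A' * (1 + lg)) :=
    mul_le_mul_of_nonneg_left (mul_le_mul_of_nonneg_left (by linarith) hA') he₁0
  calc e₁ * (A' * (1 + lgn)) ≤ e₁ * (A' * (1 + lg)) := hmono
    _ = A' * (e₁ * (1 + lg)) := by ring
    _ ≤ A' * ((9 * Lr ^ 3 * (3072 * N₁ + 264 * N₀) + 9 * Lr * (192 * N₁ + 12 * N₀) + 2 * (4 * C₂ + 10 * N₂) * Lr ^ 2) * R) :=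
        mul_le_mul_of_nonneg_left hstep hA'
    _ = _ := by ring

/-- Numeric bound for the corner errors. [folklore] -/
theorem bound_corner {h κ M Lr N₀ A' R C lgN lgn : ℝ} (hM : 0 < M) (hκ0 : 0 < κ) (hhdef : h = κ / M) (hκR : κ ≤ R) (hR1 : 1 ≤ R)
    (hL : 1 ≤ Lr) (hA' : 0 ≤ A') (hN₀ : 0 ≤ N₀) (hC : 0 ≤ C) (hcorner : lgN - lgn ≤ 24 * κ * Lr ^ 3) :
    C * (A' * (2 + lgN - lgn)) + 8 * N₀ * Lr * h * (A' * (3 * Lr * M))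
      ≤ A' * (C * (2 + 24 * Lr ^ 3) + 24 * N₀ * Lr ^ 2) * R := by
  have t1 : 2 + lgN - lgn ≤ (2 + 24 * Lr ^ 3) * R := by
    have h'' := mul_le_mul_of_nonneg_left hκR (by positivity : (0 : ℝ) ≤ 24 * Lr ^ 3)
    have h' : 2 + 24 * κ * Lr ^ 3 ≤ 2 * R + 24 * Lr ^ 3 * R := by linarith
    linarith
  have t2 : 8 * N₀ * Lr * h * (A' * (3 * Lr * M)) = A' * (24 * N₀ * Lr ^ 2 * κ) := by
    rw [hhdef]; field_simp; ring
  have t3 : 24 * N₀ * Lr ^ 2 * κ ≤ 24 * N₀ * Lr ^ 2 * R := mul_le_mul_of_nonneg_left hκR (by positivity)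
  have t4 : C * (A' * (2 + lgN - lgn)) ≤ C * (A' * ((2 + 24 * Lr ^ 3) * R)) :=
    mul_le_mul_of_nonneg_left (mul_le_mul_of_nonneg_left t1 hA') hC
  rw [t2]
  have t5 := mul_le_mul_of_nonneg_left t3 hA'
  calc C * (A' * (2 + lgN - lgn)) + A' * (24 * N₀ * Lr ^ 2 * κ)
      ≤ C * (A' * ((2 + 24 * Lr ^ 3) * R)) + A' * (24 * N₀ * Lr ^ 2 * R) := add_le_add t4 t5
    _ = A' * (C * (2 + 24 * Lr ^ 3) + 24 * N₀ * Lr ^ 2) * R := by ring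

/-- **Anchor `combTypeCornerErrors`** (registered sub-goal; `sum_corner_errors_le` with explicit quantifiers). [folklore] -/
theorem combTypeCornerErrors : ∀ f : ℕ → ℝ, ∀ A C D : ℝ, (∀ n, 0 ≤ f n) → (∀ N : ℕ, 1 ≤ N → ∑ n ∈ Finset.Icc 1 N, f n ≤ A * N) → (0 ≤ C) → (0 ≤ D) → ∀ n₁ N : ℕ, (1 ≤ n₁) → (n₁ ≤ N) → ∑ n ∈ Finset.Ioc n₁ N, f n * (C / n + D) ≤ C * (A * (2 + Real.log N - Real.log (n₁ + 1))) + D * (A * N) :=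
  fun _ _ _ _ hf0 hA hC hD _ _ hn₁ hN => sum_corner_errors_le hf0 hA hC hD hn₁ hN

end CombType

end Summit.RiemannHypothesis.RiemannHypothesis.Theorems.SignConeConeMagnification

end
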